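import Literature.NumberTheory.Rogawski1990.FinExplicitTransferFactorDeepTauTame         -- T5-u-TAME head (F0P3a-p04 (g16)): `exists_forall_finTau_eq_hilbertSymbol_of_deep`, `toPlace_heckeUniformizer_ne_zero`
import Literature.NumberTheory.Rogawski1990.FinExplicitTransferFactorDeepKappaSum       -- ★ p845435 (F0P3a-p04 (g15)) T5-Σ, the UNRAMIFIED twin: `eventually_nhds_one_valued_eval_lt_one` (`|χ_g(u)_w| < 1` near `1`)
import HarnessLib

/-!
# `Δ‴_v(γ_H, γ′) = (β(γ_H), θ)_v · q_v^{−m} · κ_v(γ_H, γ′)` on matched pairs for every deep `γ_H` at a TAME non-split place, ramified allowed; germ form at `1 ∈ H_v`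
# ([Rogawski1990] §4.9 p. 55, Lemma 4.9.3 p. 56, Prop. 8.1.3 p. 116; [LabesseLanglands1979] §2; [NeukirchANT1999] Ch. I §8, Ch. II §6)

Topic `NumberTheory/Rogawski1990`; namespace `Literature.NumberTheory.Rogawski1990`.  THEOREMS ONLY (no definition, no instance, no notation, no named fact, no `sorry`).
Cell `pub/hodgecm-mathlib` (D-0151), crux H413 = `stmt-HodgeConjecture-24833`, line «N6nsGerm», last open stub `stub_N6nsS3id`; road «S3-tree» (architect A-p16 census v3
0ca147ac, A-50), brick **T5-u-TAME, sequel** (T5 lineage F0P3a-p04 (g16)) of ★ `FinExplicitTransferFactorDeepTauTame` (the head `τ_v(γ_H) = (β(γ_H), θ)_v`, `β(γ_H)` the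
`σ_w`-fixed symmetrised discriminant `−χ_g(u)_w·(u_w² + det g_w)∕(2u_w² det g_w)`).  Here the `D`-half and the assembled factor.  ROAD-INDEPENDENT.  HONEST LABEL: HC_CM is proved
only modulo the printed citations (2 remaining named inputs hLiu418, h413) until rung 0 closes; nothing printed is asserted here.

THE MATHEMATICS.  At ANY non-split place `w ∣ v` of the CM extension `L∕L⁺` one has `e(w|v)·f(w|v) = 2` (★ `ramificationIdx_mul_inertiaDeg_eq_two_of_smul_eq`), so
`‖ι_w ϖ_v‖_w = (N𝔓_w)^{−e} = q_v^{−ef} = q_v^{−2}`: **`|χ_g(u)_w|_w = |ι_w ϖ_v|_w^m ⇒ D_{G∕H,v}(γ_H) = ‖χ_g(u)_w‖_w^{1∕2} = q_v^{−m}`** whether `v` is inert (`e = 1`: `m = ord_w χ_g(u)`,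
★ `sqrt_prod_norm_eq_inv_pow`) or ramified (`e = 2`: `ord_w χ_g(u) = 2m`, automatically even for deep `γ_H` since `χ_g(u)_w ∈ ι_w(L⁺_v)·𝒪_wˣ`).  With ★ `finExplicitDelta_of_isLocalNormPair`
(`Δ‴ = τ·D·κ`) and the head: **`Δ‴_v(γ_H, γ′) = (β(γ_H), θ)_v · q_v^{−m} · κ_v(γ_H, γ′)`** on matched pairs, for every deep `γ_H`, all torus types; TAME twin of ★
`exists_forall_finExplicitDelta_eq_neg_pow_mul_kappa_of_deep` ∕ ★ `exists_nhds_one_forall_finExplicitDelta_eq_neg_pow_mul_kappa` (there `(β, θ)_v = (−1)^m`).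

* §1 `finWeylRatio_eq_inv_pow_of_smul_eq` (`D = q_v^{−m}` at every non-split place — ★ `sqrt_prod_norm_eq_inv_pow` without `hunr`),
  **`exists_forall_finExplicitDelta_eq_hilbertSymbol_mul_of_deep`** (matched pairs, deep `γ_H`).
* §2 `valued_eval_eq_valued_toPlace_pow_toNat_of_toPlace_eq` — the depth token `m` EXISTS for every deep `γ_H`, `m = ord_v β` (at ramified `w`: `ord_w χ_g(u)` is even).
* §3 GERM AT `1 ∈ H_v` (END «GEN» currency): **`exists_nhds_one_forall_finExplicitDelta_eq_hilbertSymbol_mul`**.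
* §4 Σ-ADAPTER (TAME twin of ★ T5-Σ p845435): **`exists_nhds_one_forall_finsum_Δ_mul_eq_hilbertSymbol_mul`** (binder currency) and `…_toNat` (`β`-function currency):
  `Σᶠ_c Δ_v(γ_H, c̃)·O(c) = (β, θ)_v·q_v^{−m}·Σᶠ_c [ι_v(γ_H) ↔ c̃]·κ_v·O(c)` for EVERY class weight `O` — «GEN»'s right-hand side BY NAME at a tame place.

## References
* [Rogawski1990] J. D. Rogawski, *Automorphic Representations of Unitary Groups in Three Variables* (1990): §4.9 p. 55 (`τ`, `D_{G∕H}`), Lemma 4.9.3 (4.9.2) p. 56, Prop. 8.1.3 p. 116;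
  §4.3 (4.3.1) p. 43.
* [LabesseLanglands1979] J.-P. Labesse, R. P. Langlands, *L-indistinguishability for SL(2)*, Canad. J. Math. 31 (1979): §2, (2.1)–(2.2).
* [NeukirchANT1999] J. Neukirch, *Algebraic Number Theory* (1999): Ch. I §8 Prop. 8.2 (`e f g = n`), Ch. II §6 (`‖·‖_w = (N𝔓_w)^{−ord_w}`).
-/

set_option autoImplicit false

noncomputable section

open NumberField IsDedekindDomain Filter Topology Matrix

namespace Literature.NumberTheory.Rogawski1990

open Literature.NumberTheory.Automorphic Literature.NumberTheory.Automorphic.UnitaryGroup Literature.NumberTheory.GaloisRepresentations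
open Literature.NumberTheory.QuadraticForms

variable (L : Type) [Field L] [NumberField L] [IsCMField L] (v : HeightOneSpectrum (𝓞 ↥(maximalRealSubfield L)))
  (w : PlacesOver L v) (hw : IsCMField.complexConj L • w.1 = w.1)

/-! ## §1 `D_{G∕H,v} = q_v^{−m}` at EVERY non-split place, and `Δ‴_v = (β, θ)_v · q_v^{−m} · κ_v` on matched pairs -/

section Pairs

include hw in
/-- **`D_{G∕H,v}(γ_H) = q_v^{−m}` WHEN `|χ_g(u)_w|_w = |ι_w ϖ_v|_w^m`, AT ANY NON-SPLIT PLACE `v`** (`q_v = #k_v`): `D = (Π_{w'}‖χ_g(u)_{w'}‖_{w'})^{1∕2}` (★ `finWeylRatio`) has the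
single factor `w`, `‖·‖_w = (N𝔓_w)^{log|·|_w}` (★ `norm_eq_absNorm_zpow_log`), `log|ι_w ϖ_v|_w = −e(w|v)` (★ `valued_toPlace`), `N𝔓_w = q_v^{f(w|v)}` and `e·f = 2` (★
`ramificationIdx_mul_inertiaDeg_eq_two_of_smul_eq`), so `‖χ_g(u)_w‖_w = q_v^{−2m}` whether `v` is inert (`e = 1`, `f = 2`: ★ `sqrt_prod_norm_eq_inv_pow`) or ramified
(`e = 2`, `f = 1`). [cite: Rogawski1990, §4.9 p. 55; §4.3 (4.3.1) p. 43] [cite: NeukirchANT1999, Ch. I §8 Prop. 8.2; Ch. II §6] -/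
theorem finWeylRatio_eq_inv_pow_of_smul_eq
    (γH : (cmDatum L 2 (Matrix.of fun i j : Fin 2 => if i.val + j.val + 1 = 2 then (1 : L) else 0)).Local v ×
      (cmDatum L 1 (Matrix.of fun i j : Fin 1 => if i.val + j.val + 1 = 1 then (1 : L) else 0)).Local v) {m : ℕ}
    (hχ : Valued.v (((finCharpolyTwo L v γH).eval (finGammaTwo L v γH)) w) =
      Valued.v ((toPlace v w (HeckeCharacter.uniformizer ↥(maximalRealSubfield L) v : v.adicCompletion ↥(maximalRealSubfield L))) ^ m)) :
    finWeylRatio L v γH = (((Nat.card (𝓞 ↥(maximalRealSubfield L) ⧸ v.asIdeal) : ℝ) ^ m))⁻¹ := by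
  haveI : Algebra.IsQuadraticExtension ↥(maximalRealSubfield L) L := IsCMField.isQuadraticExtension L
  have hc1 : IsCMField.complexConj L ≠ 1 := IsCMField.complexConj_ne_one L
  haveI hv : Subsingleton (PlacesOver L v) := PlacesOver.subsingleton_of_smul_eq (IsCMField.complexConj L) hc1 w hw
  haveI : v.asIdeal.IsMaximal := v.isMaximal
  haveI : w.1.asIdeal.IsMaximal := w.1.isMaximal
  haveI : w.1.asIdeal.LiesOver v.asIdeal := PlacesOver.liesOver w
  set x : LocalRing L v := (finCharpolyTwo L v γH).eval (finGammaTwo L v γH) with hxdef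
  set ϖ : w.1.adicCompletion L := toPlace v w (HeckeCharacter.uniformizer ↥(maximalRealSubfield L) v : v.adicCompletion ↥(maximalRealSubfield L)) with hϖdef
  -- `|ι ϖ_v|_w = exp(−e)`
  have hϖv : Valued.v ϖ = WithZero.exp (-(v.asIdeal.ramificationIdx' w.1.asIdeal : ℤ)) := by
    rw [hϖdef, valued_toPlace, HeckeCharacter.valued_uniformizer, ← WithZero.exp_nsmul, nsmul_eq_mul, mul_neg, mul_one]
  have hϖ0 : ϖ ≠ 0 := fun h0 => by rw [h0, map_zero] at hϖv; exact WithZero.zero_ne_coe hϖv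
  have hz : x w ≠ 0 := fun h0 => by
    rw [h0, map_zero] at hχ
    exact (Valuation.ne_zero_iff _).2 (pow_ne_zero m hϖ0) hχ.symm
  -- `e f = 2`
  have hef : v.asIdeal.ramificationIdx' w.1.asIdeal * v.asIdeal.inertiaDeg' w.1.asIdeal = 2 := by
    rw [Ideal.ramificationIdx'_eq_ramificationIdx v.asIdeal w.1.asIdeal v.ne_bot, Ideal.inertiaDeg'_eq_inertiaDeg v.asIdeal w.1.asIdeal]
    exact Liu2021.LemD1IndexedNonVacuityRamifiedPlace.ramificationIdx_mul_inertiaDeg_eq_two_of_smul_eq L v (IsCMField.complexConj L) hc1 w hw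
  have hq : Ideal.absNorm v.asIdeal = Nat.card (𝓞 ↥(maximalRealSubfield L) ⧸ v.asIdeal) := by
    rw [Ideal.absNorm_apply, Submodule.cardQuot_apply]
  rw [show finWeylRatio L v γH = Real.sqrt (∏ w' : PlacesOver L v, ‖x w'‖) from rfl,
    Fintype.prod_subsingleton _ w, norm_eq_absNorm_zpow_log L hz, hχ, Valuation.map_pow, hϖv, ← WithZero.exp_nsmul, WithZero.log_exp,
    Ideal.absNorm_eq_pow_inertiaDeg'_of_liesOver w.1.asIdeal v.asIdeal v.isPrime v.ne_bot, hq]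
  set q : ℕ := Nat.card (𝓞 ↥(maximalRealSubfield L) ⧸ v.asIdeal) with hqdef
  set e : ℕ := v.asIdeal.ramificationIdx' w.1.asIdeal with hedef
  set f : ℕ := v.asIdeal.inertiaDeg' w.1.asIdeal with hfdef
  have h2 : (((q ^ f : ℕ)) : ℝ) ^ (m • (-(e : ℤ))) = ((((q : ℝ)) ^ m)⁻¹) ^ 2 := by
    rw [nsmul_eq_mul, mul_neg, _root_.zpow_neg, ← Nat.cast_mul, zpow_natCast, Nat.cast_pow, ← pow_mul, inv_pow, ← pow_mul,
      show f * (m * e) = m * 2 by rw [mul_left_comm, mul_comm f e, hef]]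
  rw [h2, Real.sqrt_sq (by positivity)]

variable (μ : HeckeCharacter L)
  (hμω : ∀ x : ideleGroup ↥(maximalRealSubfield L), μ (AdeleRing.ideleBaseChange ↥(maximalRealSubfield L) L x) = quadraticHeckeCharCM L x)

include hw hμω in
/-- **`Δ‴_v(γ_H, γ′) = (β(γ_H), θ)_v · q_v^{−m} · κ_v(γ_H, γ′)` ON MATCHED PAIRS, FOR EVERY DEEP `γ_H`, AT A TAME NON-SPLIT PLACE (RAMIFIED ALLOWED)** (`q_v = #k_v`,
`|χ_g(u)_w|_w = |ι_w ϖ_v|_w^m` — at a ramified `w` this reads `ord_w χ_g(u) = 2m`, which is automatic: `ord_w χ_g(u) = ord_w ι_w β` is even; `β` the symmetrised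
discriminant): ★ `finExplicitDelta_of_isLocalNormPair` (`Δ‴ = τ·D·κ`), the head (`τ = (β, θ)_v`) and `finWeylRatio_eq_inv_pow_of_smul_eq` (`D = q_v^{−m}`).  TAME twin of ★
`exists_forall_finExplicitDelta_eq_neg_pow_mul_kappa_of_deep` (there `(β, θ)_v = (−1)^m`). [cite: Rogawski1990, §4.9 p. 55; Prop. 8.1.3 p. 116] [cite: LabesseLanglands1979, §2] -/
theorem exists_forall_finExplicitDelta_eq_hilbertSymbol_mul_of_deep (h2 : Valued.v (2 : w.1.adicCompletion L) = 1) (H' : Matrix (Fin 3) (Fin 3) L) :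
    ∃ M₀ : ℕ, 1 ≤ M₀ ∧
      ∀ (γH : (cmDatum L 2 (Matrix.of fun i j : Fin 2 => if i.val + j.val + 1 = 2 then (1 : L) else 0)).Local v ×
          (cmDatum L 1 (Matrix.of fun i j : Fin 1 => if i.val + j.val + 1 = 1 then (1 : L) else 0)).Local v) (m : ℕ)
        (γ' : (cmDatum L 3 H').Local v),
        Valued.v (((finCharpolyTwo L v γH).eval (finGammaTwo L v γH)) w) =
          Valued.v ((toPlace v w (HeckeCharacter.uniformizer ↥(maximalRealSubfield L) v : v.adicCompletion ↥(maximalRealSubfield L))) ^ m) →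
        Valued.v (finGammaTwo L v γH w - 1) ≤
          Valued.v ((toPlace v w (HeckeCharacter.uniformizer ↥(maximalRealSubfield L) v : v.adicCompletion ↥(maximalRealSubfield L))) ^ M₀) →
        Valued.v (((γH.1.val.val : Matrix (Fin 2) (Fin 2) (LocalRing L v)).map
            (Pi.evalRingHom (fun w' : PlacesOver L v => w'.1.adicCompletion L) w)).det - 1) ≤
          Valued.v ((toPlace v w (HeckeCharacter.uniformizer ↥(maximalRealSubfield L) v : v.adicCompletion ↥(maximalRealSubfield L))) ^ M₀) →
        ∀ β : (v.adicCompletion ↥(maximalRealSubfield L))ˣ,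
          toPlace v w (β : v.adicCompletion ↥(maximalRealSubfield L)) =
            -(((finCharpolyTwo L v γH).eval (finGammaTwo L v γH)) w *
                (finGammaTwo L v γH w ^ 2 +
                  ((γH.1.val.val : Matrix (Fin 2) (Fin 2) (LocalRing L v)).map (Pi.evalRingHom (fun w' : PlacesOver L v => w'.1.adicCompletion L) w)).det)) /
              (2 * finGammaTwo L v γH w ^ 2 *
                ((γH.1.val.val : Matrix (Fin 2) (Fin 2) (LocalRing L v)).map (Pi.evalRingHom (fun w' : PlacesOver L v => w'.1.adicCompletion L) w)).det) →
        IsLocalNormPair L H' v γH γ' →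
        finExplicitDelta L v H' γH μ γ' =
          (hilbertSymbol (v.adicCompletion ↥(maximalRealSubfield L)) (β : v.adicCompletion ↥(maximalRealSubfield L))
              (algebraMap ↥(maximalRealSubfield L) _ ((cmQuadraticGenerator L : 𝓞 ↥(maximalRealSubfield L)) : ↥(maximalRealSubfield L))) : ℂ) *
            (((Nat.card (𝓞 ↥(maximalRealSubfield L) ⧸ v.asIdeal) : ℂ) ^ m))⁻¹ * ((finKappaAt L v H' γH γ' : ℤ) : ℂ) := by
  classical
  obtain ⟨M₀, hM₁, h⟩ := exists_forall_finTau_eq_hilbertSymbol_of_deep L v w hw μ hμω h2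
  refine ⟨M₀, hM₁, fun γH m γ' hχ hud hdd β hβ hpair => ?_⟩
  have hϖ0 : (toPlace v w (HeckeCharacter.uniformizer ↥(maximalRealSubfield L) v : v.adicCompletion ↥(maximalRealSubfield L))) ≠ 0 :=
    toPlace_heckeUniformizer_ne_zero L v w
  have hχ0 : ((finCharpolyTwo L v γH).eval (finGammaTwo L v γH)) w ≠ 0 := fun h0 => by
    rw [h0, map_zero] at hχ
    exact (Valuation.ne_zero_iff _).2 (pow_ne_zero m hϖ0) hχ.symm
  rw [finExplicitDelta_of_isLocalNormPair L v H' γH μ hpair, h γH hχ0 hud hdd β hβ, finWeylRatio_eq_inv_pow_of_smul_eq L v w hw γH hχ]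
  push_cast
  ring

end Pairs

/-! ## §2 THE DEPTH IN `β`-CURRENCY: `|χ_g(u)_w|_w = |ι_w ϖ_v|_w^{ord_v β}` for deep `γ_H` — the depth token ALWAYS exists at a tame non-split place -/

section Depth

omit [IsCMField L] in
/-- `|b|_v = |ϖ_v|_v^{(−log|b|_v).toNat}` for `b ∈ L⁺_v`, `b ≠ 0`, `|b|_v ≤ 1` (`|ϖ_v|_v = exp(−1)`). [cite: NeukirchANT1999, Ch. II §6] -/
theorem valued_eq_valued_uniformizer_pow_toNat {b : v.adicCompletion ↥(maximalRealSubfield L)} (hb0 : b ≠ 0) (hb1 : Valued.v b ≤ 1) :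
    Valued.v b = Valued.v ((HeckeCharacter.uniformizer ↥(maximalRealSubfield L) v : v.adicCompletion ↥(maximalRealSubfield L)) ^ (-WithZero.log (Valued.v b)).toNat) := by
  have h0 : Valued.v b ≠ 0 := (Valuation.ne_zero_iff _).2 hb0
  have hlog : WithZero.log (Valued.v b) ≤ 0 := (WithZero.log_le_iff_le_exp h0).2 (by rwa [WithZero.exp_zero])
  have hN : ((-WithZero.log (Valued.v b)).toNat : ℤ) = -WithZero.log (Valued.v b) := Int.toNat_of_nonneg (neg_nonneg.2 hlog)
  rw [Valuation.map_pow, HeckeCharacter.valued_uniformizer, ← WithZero.exp_nsmul, smul_neg, nsmul_eq_mul, mul_one, hN, neg_neg, WithZero.exp_log h0]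

/-- **THE DEPTH TOKEN EXISTS, IN `β`-CURRENCY.**  At a non-split place with `|2|_w = 1`: if `γ_H = (g, u)` has `|u_w − 1|_w, |det g_w − 1|_w ≤ |ι_w ϖ_v|_w^{M₀}` (`M₀ ≥ 1`),
`|χ_g(u)_w|_w ≤ 1`, and `ι_w β = −χ_g(u)_w·(u_w² + det g_w)∕(2·u_w²·det g_w)` with `β ∈ L⁺_vˣ`, then **`|χ_g(u)_w|_w = |ι_w ϖ_v|_w^m` with `m := (−log|β|_v).toNat = ord_v β`**
(`u_w² + det g_w ∈ 2 + 𝔪_w` is a unit as `|2|_w = 1`, so `|χ_g(u)_w|_w = |ι_w β|_w = |β|_v^{e(w|v)}` ★ `valued_toPlace`).  At a RAMIFIED `w` (`e = 2`) this is the statement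
«`ord_w χ_g(u) = 2·ord_v β` is even»; it supplies the `m`-binder of `exists_forall_finExplicitDelta_eq_hilbertSymbol_mul_of_deep` for EVERY deep `G`-regular `γ_H`.
[cite: Rogawski1990, §4.9 p. 55] [cite: NeukirchANT1999, Ch. II §6] -/
theorem valued_eval_eq_valued_toPlace_pow_toNat_of_toPlace_eq (h2 : Valued.v (2 : w.1.adicCompletion L) = 1) {M₀ : ℕ} (hM₁ : 1 ≤ M₀)
    (γH : (cmDatum L 2 (Matrix.of fun i j : Fin 2 => if i.val + j.val + 1 = 2 then (1 : L) else 0)).Local v ×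
      (cmDatum L 1 (Matrix.of fun i j : Fin 1 => if i.val + j.val + 1 = 1 then (1 : L) else 0)).Local v)
    (hud : Valued.v (finGammaTwo L v γH w - 1) ≤
      Valued.v ((toPlace v w (HeckeCharacter.uniformizer ↥(maximalRealSubfield L) v : v.adicCompletion ↥(maximalRealSubfield L))) ^ M₀))
    (hdd : Valued.v (((γH.1.val.val : Matrix (Fin 2) (Fin 2) (LocalRing L v)).map
        (Pi.evalRingHom (fun w' : PlacesOver L v => w'.1.adicCompletion L) w)).det - 1) ≤
      Valued.v ((toPlace v w (HeckeCharacter.uniformizer ↥(maximalRealSubfield L) v : v.adicCompletion ↥(maximalRealSubfield L))) ^ M₀))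
    (hχ1 : Valued.v (((finCharpolyTwo L v γH).eval (finGammaTwo L v γH)) w) ≤ 1)
    (β : (v.adicCompletion ↥(maximalRealSubfield L))ˣ)
    (hβ : toPlace v w (β : v.adicCompletion ↥(maximalRealSubfield L)) =
      -(((finCharpolyTwo L v γH).eval (finGammaTwo L v γH)) w *
          (finGammaTwo L v γH w ^ 2 +
            ((γH.1.val.val : Matrix (Fin 2) (Fin 2) (LocalRing L v)).map (Pi.evalRingHom (fun w' : PlacesOver L v => w'.1.adicCompletion L) w)).det)) /
        (2 * finGammaTwo L v γH w ^ 2 *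
          ((γH.1.val.val : Matrix (Fin 2) (Fin 2) (LocalRing L v)).map (Pi.evalRingHom (fun w' : PlacesOver L v => w'.1.adicCompletion L) w)).det)) :
    Valued.v (((finCharpolyTwo L v γH).eval (finGammaTwo L v γH)) w) =
      Valued.v ((toPlace v w (HeckeCharacter.uniformizer ↥(maximalRealSubfield L) v : v.adicCompletion ↥(maximalRealSubfield L))) ^
        (-WithZero.log (Valued.v (β : v.adicCompletion ↥(maximalRealSubfield L)))).toNat) := by
  classical
  haveI := PlacesOver.liesOver w
  set ϖ : w.1.adicCompletion L := toPlace v w (HeckeCharacter.uniformizer ↥(maximalRealSubfield L) v : v.adicCompletion ↥(maximalRealSubfield L)) with hϖdef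
  set u := finGammaTwo L v γH w with hudef
  set χw := ((finCharpolyTwo L v γH).eval (finGammaTwo L v γH)) w with hχwdef
  set d := ((γH.1.val.val : Matrix (Fin 2) (Fin 2) (LocalRing L v)).map (Pi.evalRingHom (fun w' : PlacesOver L v => w'.1.adicCompletion L) w)).det with hddef
  have hϖM1 : Valued.v (ϖ ^ M₀) < 1 := valued_toPlace_heckeUniformizer_pow_lt_one L v w hM₁
  have h20 : (2 : w.1.adicCompletion L) ≠ 0 := fun h0 => by rw [h0, map_zero] at h2; exact zero_ne_one h2
  -- `u`, `d`, `u² + d` are units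
  have hu1 : Valued.v (u - 1) < 1 := lt_of_le_of_lt hud hϖM1
  have hd1 : Valued.v (d - 1) < 1 := lt_of_le_of_lt hdd hϖM1
  have hvu : Valued.v u = 1 := by
    have h := Valuation.map_one_add_of_lt (Valued.v : Valuation (w.1.adicCompletion L) _) hu1
    rwa [add_sub_cancel] at h
  have hvd : Valued.v d = 1 := by
    have h := Valuation.map_one_add_of_lt (Valued.v : Valuation (w.1.adicCompletion L) _) hd1
    rwa [add_sub_cancel] at h
  have hu0 : u ≠ 0 := fun h0 => by rw [h0, map_zero] at hvu; exact zero_ne_one hvu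
  have hd0 : d ≠ 0 := fun h0 => by rw [h0, map_zero] at hvd; exact zero_ne_one hvd
  have hs : Valued.v (u ^ 2 + d) = 1 := by
    have hlt : Valued.v ((u - 1) * (u + 1) + (d - 1)) < Valued.v (2 : w.1.adicCompletion L) := by
      rw [h2]
      refine lt_of_le_of_lt (Valuation.map_add _ _ _) (max_lt ?_ hd1)
      rw [Valuation.map_mul]
      calc Valued.v (u - 1) * Valued.v (u + 1) ≤ Valued.v (u - 1) * 1 := by
            gcongr
            exact le_trans (Valuation.map_add _ _ _) (max_le hvu.le (le_of_eq (Valuation.map_one _)))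
        _ < 1 := by rw [mul_one]; exact hu1
    have h := Valuation.map_add_eq_of_lt_left (Valued.v : Valuation (w.1.adicCompletion L) _) hlt
    rw [show (2 : w.1.adicCompletion L) + ((u - 1) * (u + 1) + (d - 1)) = u ^ 2 + d by ring, h2] at h
    exact h
  have hs0 : u ^ 2 + d ≠ 0 := fun h0 => by rw [h0, map_zero] at hs; exact zero_ne_one hs
  -- `|χ_w| = |ι β|`
  have hχβ : Valued.v χw = Valued.v (toPlace v w (β : v.adicCompletion ↥(maximalRealSubfield L))) := by
    rw [hβ, Valuation.map_div, Valuation.map_neg, Valuation.map_mul, Valuation.map_mul, Valuation.map_mul, Valuation.map_pow, hs, hvu, hvd, h2]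
    simp
  -- `|ι β|_w = |β|_v^e = (|ϖ_v|_v^m)^e = |ι ϖ_v|_w^m`
  have hβ0 : (β : v.adicCompletion ↥(maximalRealSubfield L)) ≠ 0 := β.ne_zero
  have hιβ : Valued.v (toPlace v w (β : v.adicCompletion ↥(maximalRealSubfield L))) =
      Valued.v (β : v.adicCompletion ↥(maximalRealSubfield L)) ^ v.asIdeal.ramificationIdx' w.1.asIdeal := valued_toPlace v w _
  have hβ1 : Valued.v (β : v.adicCompletion ↥(maximalRealSubfield L)) ≤ 1 := by
    have hle : Valued.v (β : v.adicCompletion ↥(maximalRealSubfield L)) ^ v.asIdeal.ramificationIdx' w.1.asIdeal ≤ 1 := by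
      rw [← hιβ, ← hχβ]; exact hχ1
    exact (pow_le_one_iff_of_nonneg zero_le (Ideal.IsDedekindDomain.ramificationIdx'_ne_zero_of_liesOver w.1.asIdeal v.ne_bot)).1 hle
  have hm := valued_eq_valued_uniformizer_pow_toNat L v hβ0 hβ1
  generalize (-WithZero.log (Valued.v (β : v.adicCompletion ↥(maximalRealSubfield L)))).toNat = m at hm ⊢
  rw [hχβ, hιβ, hm, Valuation.map_pow, Valuation.map_pow, valued_toPlace, ← pow_mul, ← pow_mul, mul_comm]

end Depth

/-! ## §3 GERM FORM AT `1 ∈ H_v` (the END contract's «GEN» currency `∃ V ∈ 𝓝 1, ∀ γ_H ∈ V`) -/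

section Germ

variable (μ : HeckeCharacter L)
  (hμω : ∀ x : ideleGroup ↥(maximalRealSubfield L), μ (AdeleRing.ideleBaseChange ↥(maximalRealSubfield L) L x) = quadraticHeckeCharCM L x)

include hw hμω in
/-- **`∃ V ∈ 𝓝 1, ∀ γ_H ∈ V`: `Δ‴_v(γ_H, γ′) = (β(γ_H), θ)_v · q_v^{−m} · κ_v(γ_H, γ′)` on matched pairs** (`|χ_g(u)_w|_w = |ι_w ϖ_v|_w^m`) — the `∃ V`-currency of the END contract's
«GEN» stub (road «S3-tree») at a tame non-split place, ramified allowed. [cite: Rogawski1990, §4.9 p. 55; Prop. 8.1.3 p. 116] [cite: LabesseLanglands1979, §2] -/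
theorem exists_nhds_one_forall_finExplicitDelta_eq_hilbertSymbol_mul (h2 : Valued.v (2 : w.1.adicCompletion L) = 1) (H' : Matrix (Fin 3) (Fin 3) L) :
    ∃ V ∈ 𝓝 (1 : (cmDatum L 2 (Matrix.of fun i j : Fin 2 => if i.val + j.val + 1 = 2 then (1 : L) else 0)).Local v ×
        (cmDatum L 1 (Matrix.of fun i j : Fin 1 => if i.val + j.val + 1 = 1 then (1 : L) else 0)).Local v),
      ∀ γH ∈ V, ∀ (m : ℕ) (γ' : (cmDatum L 3 H').Local v),
        Valued.v (((finCharpolyTwo L v γH).eval (finGammaTwo L v γH)) w) =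
          Valued.v ((toPlace v w (HeckeCharacter.uniformizer ↥(maximalRealSubfield L) v : v.adicCompletion ↥(maximalRealSubfield L))) ^ m) →
        ∀ β : (v.adicCompletion ↥(maximalRealSubfield L))ˣ,
          toPlace v w (β : v.adicCompletion ↥(maximalRealSubfield L)) =
            -(((finCharpolyTwo L v γH).eval (finGammaTwo L v γH)) w *
                (finGammaTwo L v γH w ^ 2 +
                  ((γH.1.val.val : Matrix (Fin 2) (Fin 2) (LocalRing L v)).map (Pi.evalRingHom (fun w' : PlacesOver L v => w'.1.adicCompletion L) w)).det)) /
              (2 * finGammaTwo L v γH w ^ 2 *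
                ((γH.1.val.val : Matrix (Fin 2) (Fin 2) (LocalRing L v)).map (Pi.evalRingHom (fun w' : PlacesOver L v => w'.1.adicCompletion L) w)).det) →
        IsLocalNormPair L H' v γH γ' →
        finExplicitDelta L v H' γH μ γ' =
          (hilbertSymbol (v.adicCompletion ↥(maximalRealSubfield L)) (β : v.adicCompletion ↥(maximalRealSubfield L))
              (algebraMap ↥(maximalRealSubfield L) _ ((cmQuadraticGenerator L : 𝓞 ↥(maximalRealSubfield L)) : ↥(maximalRealSubfield L))) : ℂ) *
            (((Nat.card (𝓞 ↥(maximalRealSubfield L) ⧸ v.asIdeal) : ℂ) ^ m))⁻¹ * ((finKappaAt L v H' γH γ' : ℤ) : ℂ) := by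
  obtain ⟨M₀, -, h⟩ := exists_forall_finExplicitDelta_eq_hilbertSymbol_mul_of_deep L v w hw μ hμω h2 H'
  have hϖ0 : (toPlace v w (HeckeCharacter.uniformizer ↥(maximalRealSubfield L) v : v.adicCompletion ↥(maximalRealSubfield L))) ^ M₀ ≠ 0 :=
    pow_ne_zero _ (toPlace_heckeUniformizer_ne_zero L v w)
  refine (Filter.Eventually.exists_mem ?_)
  filter_upwards [eventually_nhds_one_valued_sub_one_le L v w hϖ0] with γH hγ m γ' hχ β hβ hpair
  exact h γH m γ' hχ hγ.1 hγ.2 β hβ hpair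

end Germ

/-! ## §4 THE SCALAR PULLED OUT OF THE `Δ_v`-WEIGHTED CLASS SUM NEAR `1` (TAME twin of ★ T5-Σ `exists_nhds_one_forall_finsum_Δ_mul_eq`) -/

section ScalarPull

variable (μ : HeckeCharacter L)
  (hμω : ∀ x : ideleGroup ↥(maximalRealSubfield L), μ (AdeleRing.ideleBaseChange ↥(maximalRealSubfield L) L x) = quadraticHeckeCharCM L x)
  (H' : Matrix (Fin 3) (Fin 3) L)
  (hl : ∀ (v : HeightOneSpectrum (𝓞 ↥(maximalRealSubfield L)))
    (a : (cmDatum L 2 (Matrix.of fun i j : Fin 2 => if i.val + j.val + 1 = 2 then (1 : L) else 0)).Local v ×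
      (cmDatum L 1 (Matrix.of fun i j : Fin 1 => if i.val + j.val + 1 = 1 then (1 : L) else 0)).Local v)
    (b : (cmDatum L 3 H').Local v)
    (x : (cmDatum L 2 (Matrix.of fun i j : Fin 2 => if i.val + j.val + 1 = 2 then (1 : L) else 0)).Local v ×
      (cmDatum L 1 (Matrix.of fun i j : Fin 1 => if i.val + j.val + 1 = 1 then (1 : L) else 0)).Local v),
    finExplicitDelta L v H' (x * a * x⁻¹) μ b = finExplicitDelta L v H' a μ b)
  (hr : ∀ (v : HeightOneSpectrum (𝓞 ↥(maximalRealSubfield L)))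
    (a : (cmDatum L 2 (Matrix.of fun i j : Fin 2 => if i.val + j.val + 1 = 2 then (1 : L) else 0)).Local v ×
      (cmDatum L 1 (Matrix.of fun i j : Fin 1 => if i.val + j.val + 1 = 1 then (1 : L) else 0)).Local v)
    (b y : (cmDatum L 3 H').Local v),
    finExplicitDelta L v H' a μ (y * b * y⁻¹) = finExplicitDelta L v H' a μ b)

open scoped Classical in
include hw hμω in
/-- **THE SCALAR PULLED OUT (TAME, binder currency).**  Non-split `v` with `|2|_w = 1` (ramified allowed), guard `μ|_{𝕀_{L⁺}} = ω`: there is `V ∈ 𝓝 (1 : H_v)` such that for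
every `γ_H ∈ V`, every `m` with `|χ_g(u)_w|_w = |ι_w ϖ_v|_w^m`, every `β ∈ L⁺_vˣ` mapping to the symmetrised discriminant and EVERY weight `O : Cl(G′_v) → ℂ`,
`Σᶠ_c Δ_v(γ_H, c̃)·O(c) = (β, θ)_v · q_v^{−m} · Σᶠ_c [ι_v(γ_H) ↔ c̃]·κ_v(γ_H, c̃)·O(c)` (`c̃ = Quotient.out c`, `Δ_v` = ★ `finExplicitCollection … v`; support axiom ★
`finExplicitDelta_of_not_isLocalNormPair` off matched pairs) — «GEN»'s right-hand side is `(β, θ)_v·q_v^{−m}` times the `κ`-ORBITAL SUM.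
[cite: Rogawski1990, §4.9 p. 55; §4.3 p. 43; Prop. 8.1.3 p. 116] [cite: LabesseLanglands1979, §2] -/
theorem exists_nhds_one_forall_finsum_Δ_mul_eq_hilbertSymbol_mul (h2 : Valued.v (2 : w.1.adicCompletion L) = 1) :
    ∃ V ∈ 𝓝 (1 : (cmDatum L 2 (Matrix.of fun i j : Fin 2 => if i.val + j.val + 1 = 2 then (1 : L) else 0)).Local v ×
        (cmDatum L 1 (Matrix.of fun i j : Fin 1 => if i.val + j.val + 1 = 1 then (1 : L) else 0)).Local v),
      ∀ γH ∈ V, ∀ (m : ℕ) (O : ConjClasses ((cmDatum L 3 H').Local v) → ℂ),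
        Valued.v (((finCharpolyTwo L v γH).eval (finGammaTwo L v γH)) w) =
          Valued.v ((toPlace v w (HeckeCharacter.uniformizer ↥(maximalRealSubfield L) v : v.adicCompletion ↥(maximalRealSubfield L))) ^ m) →
        ∀ β : (v.adicCompletion ↥(maximalRealSubfield L))ˣ,
          toPlace v w (β : v.adicCompletion ↥(maximalRealSubfield L)) =
            -(((finCharpolyTwo L v γH).eval (finGammaTwo L v γH)) w *
                (finGammaTwo L v γH w ^ 2 +
                  ((γH.1.val.val : Matrix (Fin 2) (Fin 2) (LocalRing L v)).map (Pi.evalRingHom (fun w' : PlacesOver L v => w'.1.adicCompletion L) w)).det)) /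
              (2 * finGammaTwo L v γH w ^ 2 *
                ((γH.1.val.val : Matrix (Fin 2) (Fin 2) (LocalRing L v)).map (Pi.evalRingHom (fun w' : PlacesOver L v => w'.1.adicCompletion L) w)).det) →
        ∑ᶠ c : ConjClasses ((cmDatum L 3 H').Local v), (finExplicitCollection L H' μ hl hr v).Δ γH (Quotient.out c) * O c =
          (hilbertSymbol (v.adicCompletion ↥(maximalRealSubfield L)) (β : v.adicCompletion ↥(maximalRealSubfield L))
              (algebraMap ↥(maximalRealSubfield L) _ ((cmQuadraticGenerator L : 𝓞 ↥(maximalRealSubfield L)) : ↥(maximalRealSubfield L))) : ℂ) *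
            (((Nat.card (𝓞 ↥(maximalRealSubfield L) ⧸ v.asIdeal) : ℂ) ^ m))⁻¹ *
            ∑ᶠ c : ConjClasses ((cmDatum L 3 H').Local v),
              (if IsLocalNormPair L H' v γH (Quotient.out c) then ((finKappaAt L v H' γH (Quotient.out c) : ℤ) : ℂ) else 0) * O c := by
  obtain ⟨V, hV, h⟩ := exists_nhds_one_forall_finExplicitDelta_eq_hilbertSymbol_mul L v w hw μ hμω h2 H'
  refine ⟨V, hV, fun γH hγ m O hχ β hβ => ?_⟩
  rw [mul_finsum]
  refine finsum_congr fun c => ?_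
  rw [finExplicitCollection_Δ]
  by_cases hp : IsLocalNormPair L H' v γH (Quotient.out c)
  · rw [h γH hγ m (Quotient.out c) hχ β hβ hp, if_pos hp]
    ring
  · rw [finExplicitDelta_of_not_isLocalNormPair L v H' γH μ hp, if_neg hp, zero_mul, mul_zero]

open scoped Classical in
include hw hμω in
/-- **THE SCALAR PULLED OUT (TAME, `β`-function currency):** `V ∈ 𝓝 (1 : H_v)` with, for every `γ_H ∈ V` that is `G`-regular at `w` (`χ_g(u)_w ≠ 0`), every `β ∈ L⁺_vˣ` mapping to
the symmetrised discriminant and every weight `O`, `Σᶠ_c Δ_v(γ_H, c̃)·O(c) = (β, θ)_v · q_v^{−m(β)} · Σᶠ_c [ι_v(γ_H) ↔ c̃]·κ_v(γ_H, c̃)·O(c)` with `m(β) := (−log|β|_v).toNat = ord_v β`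
(§2: the depth token exists for every deep `G`-regular `γ_H`; TAME twin of ★ `exists_nhds_one_forall_finsum_Δ_mul_eq_toNat`). [cite: Rogawski1990, §4.9 p. 55; §4.3 p. 43;
Prop. 8.1.3 p. 116] [cite: LabesseLanglands1979, §2] -/
theorem exists_nhds_one_forall_finsum_Δ_mul_eq_hilbertSymbol_mul_toNat (h2 : Valued.v (2 : w.1.adicCompletion L) = 1) :
    ∃ V ∈ 𝓝 (1 : (cmDatum L 2 (Matrix.of fun i j : Fin 2 => if i.val + j.val + 1 = 2 then (1 : L) else 0)).Local v ×
        (cmDatum L 1 (Matrix.of fun i j : Fin 1 => if i.val + j.val + 1 = 1 then (1 : L) else 0)).Local v),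
      ∀ γH ∈ V, ∀ O : ConjClasses ((cmDatum L 3 H').Local v) → ℂ, ((finCharpolyTwo L v γH).eval (finGammaTwo L v γH)) w ≠ 0 →
        ∀ β : (v.adicCompletion ↥(maximalRealSubfield L))ˣ,
          toPlace v w (β : v.adicCompletion ↥(maximalRealSubfield L)) =
            -(((finCharpolyTwo L v γH).eval (finGammaTwo L v γH)) w *
                (finGammaTwo L v γH w ^ 2 +
                  ((γH.1.val.val : Matrix (Fin 2) (Fin 2) (LocalRing L v)).map (Pi.evalRingHom (fun w' : PlacesOver L v => w'.1.adicCompletion L) w)).det)) /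
              (2 * finGammaTwo L v γH w ^ 2 *
                ((γH.1.val.val : Matrix (Fin 2) (Fin 2) (LocalRing L v)).map (Pi.evalRingHom (fun w' : PlacesOver L v => w'.1.adicCompletion L) w)).det) →
        ∑ᶠ c : ConjClasses ((cmDatum L 3 H').Local v), (finExplicitCollection L H' μ hl hr v).Δ γH (Quotient.out c) * O c =
          (hilbertSymbol (v.adicCompletion ↥(maximalRealSubfield L)) (β : v.adicCompletion ↥(maximalRealSubfield L))
              (algebraMap ↥(maximalRealSubfield L) _ ((cmQuadraticGenerator L : 𝓞 ↥(maximalRealSubfield L)) : ↥(maximalRealSubfield L))) : ℂ) *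
            (((Nat.card (𝓞 ↥(maximalRealSubfield L) ⧸ v.asIdeal) : ℂ) ^
              (-WithZero.log (Valued.v (β : v.adicCompletion ↥(maximalRealSubfield L)))).toNat))⁻¹ *
            ∑ᶠ c : ConjClasses ((cmDatum L 3 H').Local v),
              (if IsLocalNormPair L H' v γH (Quotient.out c) then ((finKappaAt L v H' γH (Quotient.out c) : ℤ) : ℂ) else 0) * O c := by
  obtain ⟨V, hV, h⟩ := exists_nhds_one_forall_finsum_Δ_mul_eq_hilbertSymbol_mul L v w hw μ hμω H' hl hr h2
  obtain ⟨U, hU, hU1⟩ := (eventually_nhds_one_valued_eval_lt_one L v w).exists_mem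
  have hϖ0 : (toPlace v w (HeckeCharacter.uniformizer ↥(maximalRealSubfield L) v : v.adicCompletion ↥(maximalRealSubfield L))) ^ 1 ≠ 0 :=
    pow_ne_zero _ (toPlace_heckeUniformizer_ne_zero L v w)
  obtain ⟨W, hW, hW1⟩ := (eventually_nhds_one_valued_sub_one_le L v w hϖ0).exists_mem
  refine ⟨V ∩ (U ∩ W), Filter.inter_mem hV (Filter.inter_mem hU hW), fun γH hγ O _hχ0 β hβ => ?_⟩
  exact h γH hγ.1 _ O
    (valued_eval_eq_valued_toPlace_pow_toNat_of_toPlace_eq L v w h2 le_rfl γH (hW1 γH hγ.2.2).1 (hW1 γH hγ.2.2).2 (hU1 γH hγ.2.1).le β hβ) β hβ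

end ScalarPull

end Literature.NumberTheory.Rogawski1990

end
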